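import Literature.IUT.LogVolume.WeightDescent
import Literature.IUT.LogVolume.CompletionLocalFields
import Literature.NumberTheory.Automorphic.GaloisActionPlaces
import HarnessLib

/-!
# Weight descent for EXPECTATIONS: a Galois-invariant packet summand averages over `V(K)_p` as over `V(F₀)_p`

Dupuy–Hilado, *Statement of Mochizuki's Cor. 3.12* (arXiv:2004.13228) §3.6 / [IUTchIV] Thm. 1.10 proof Step (v)
(kurims p. 28, "after passing to weighted averages"): the `(j+1)`-tensor packets over a rational prime `p` are
indexed by tuples of places and weighted by `Pr(v⃗) = Π_a Pr(v_a)`, `Pr(v) = n_v/[F:ℚ]` (tree: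
`Literature.IUT.LogVolume.weight`). The companion file `WeightDescent.lean` proves that along a finite extension
`K/F₀` the WEIGHTS descend fibrewise (`sum_subtype_placesOver_prod_weight_eq`:
`Σ_{w⃗ over v⃗} Pr_K(w⃗) = Pr_{F₀}(v⃗)`) and leaves "Galois-invariance of a SUMMAND (so that a `K`-level weighted
average over the fibre collapses to the `F₀`-level term)" to the consumer. THIS FILE is that consumer step, once
and for all:

* `sum_prod_weight_mul_eq_of_fibreConst` — for a summand `q : (ι → V(K)_p) → ℝ` that is CONSTANT ON THE FIBRES of
  `w⃗ ↦ v⃗ = (w_a ∩ 𝓞_{F₀})_a` and ANY section `s` of `V(K)_p → V(F₀)_p`: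
  `Σ_{w⃗} Pr_K(w⃗)·q(w⃗) = Σ_{v⃗} Pr_{F₀}(v⃗)·q(s ∘ v⃗)` (regroup by fibres, `Fintype.sum_fiberwise`, and descend the
  weights); one-place form `sum_weight_mul_eq_of_fibreConst`;
* `fibreConst_of_smul_invariant` — for `K/F₀` GALOIS, a summand invariant under the componentwise action of
  `Gal(K/F₀)^ι` on tuples of places (`Literature.NumberTheory.Automorphic.instMulActionHeightOneSpectrum`) is
  constant on the fibres (transitivity of `Gal(K/F₀)` on the places over a given place of `F₀`,
  `HeightOneSpectrum.exists_algEquiv_smul_eq` = Cassels–Fröhlich VII Prop. 1.2 (ii));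
* `sum_prod_weight_mul_eq_of_smul_invariant` / `…_placeSection` — the composite: for `K/F₀` Galois and a
  Galois-invariant summand, the `Pr_K`-expectation over `V(K)_p^ι` equals the `Pr_{F₀}`-expectation of its values
  at the CHOSEN places `v̲⃗` of any section (`PlaceSection F₀ K`, [IUTchI] Def. 3.1 (e) "`V̲ ⥲ V_mod`");
* `exists_section_placesOver` — sections of `V(K)_p → V(F₀)_p` exist.

This is the junction by which a `K`-indexed packet average (e.g. the Θ-side `procession-normalised` log-volume of a
setting typed over ALL places of `K`) is compared with an `F_mod`-indexed one over the section `V̲`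
([IUTchI] Rmk. 3.1.5: `K/F_mod` is Galois, tree `InitialThetaData.isGalois_fieldOfModuli_K`); the per-summand
invariance is discharged by the consumer from the Galois transport of completions
(`Literature.NumberTheory.Automorphic.galAdicCompletionEquiv`, `valued_galAdicCompletionMap`).
Classical; THEOREMS ONLY, no definitions, no named facts. Written for the abc-iut cell (G1-Θ route α step (W),
consumer side; K-level provenance line). Nothing here bears on [IUTchIII] Cor. 3.12.
-/

noncomputable section

namespace Literature.IUT.LogVolume

open NumberField IsDedekindDomain Finset Literature.NumberTheory.Automorphic
open scoped Pointwise

variable (F₀ K : Type) [Field F₀] [NumberField F₀] [Field K] [NumberField K] [Algebra F₀ K]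

/-! ## 1. Places: `finBelow` versus Mathlib's `under`, conjugate places stay over `p`, sections exist -/

omit [NumberField F₀] [NumberField K] in
/-- The tree's `finBelow F₀ K w` ([IUTchIV] Def. 1.9 (ii) vocabulary) IS Mathlib's `w.under (𝓞 F₀)`.
[cite: NeukirchANT1999, Ch. I §8] -/
theorem finBelow_eq_under (w : HeightOneSpectrum (𝓞 K)) : finBelow F₀ K w = w.under (𝓞 F₀) :=
  HeightOneSpectrum.ext rfl

/-- A place of `K` lies over `p` as soon as the place of `F₀` under it does (transitivity of "lies over").
[cite: NeukirchANT1999, Ch. I §8] -/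
theorem mem_placesOver_of_finBelow_mem {p : ℕ} [Fact p.Prime] {w : HeightOneSpectrum (𝓞 K)}
    (hw : finBelow F₀ K w ∈ placesOver F₀ p) : w ∈ placesOver K p := by
  rw [mem_placesOver_iff] at hw ⊢
  haveI := hw
  haveI : w.asIdeal.LiesOver (finBelow F₀ K w).asIdeal := liesOver_finBelow F₀ K w
  exact Ideal.LiesOver.trans w.asIdeal (finBelow F₀ K w).asIdeal _

/-- `w ∈ V(K)_p ↔ (w ∩ 𝓞_{F₀}) ∈ V(F₀)_p`. [cite: NeukirchANT1999, Ch. I §8] -/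
theorem mem_placesOver_iff_finBelow_mem {p : ℕ} [Fact p.Prime] (w : HeightOneSpectrum (𝓞 K)) :
    w ∈ placesOver K p ↔ finBelow F₀ K w ∈ placesOver F₀ p :=
  ⟨fun hw => finBelow_mem_placesOver F₀ K hw, fun hw => mem_placesOver_of_finBelow_mem F₀ K hw⟩

/-- **Conjugate places lie over the same place of `F₀`**, in the tree's `finBelow` vocabulary
(`Literature.NumberTheory.Automorphic.HeightOneSpectrum.under_algEquiv_smul`).
[cite: CasselsFrohlichANT1967, Ch. VII §1.1] -/
theorem finBelow_smul (g : K ≃ₐ[F₀] K) (w : HeightOneSpectrum (𝓞 K)) :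
    finBelow F₀ K (g • w) = finBelow F₀ K w := by
  rw [finBelow_eq_under, finBelow_eq_under]
  exact HeightOneSpectrum.under_algEquiv_smul (F := F₀) K g w

/-- A Galois conjugate of a place over `p` lies over `p`. [cite: CasselsFrohlichANT1967, Ch. VII §1.1] -/
theorem smul_mem_placesOver {p : ℕ} [Fact p.Prime] (g : K ≃ₐ[F₀] K) {w : HeightOneSpectrum (𝓞 K)}
    (hw : w ∈ placesOver K p) : g • w ∈ placesOver K p := by
  rw [mem_placesOver_iff_finBelow_mem F₀ K, finBelow_smul]
  exact finBelow_mem_placesOver F₀ K hw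

/-- **Sections of `V(K)_p → V(F₀)_p` exist** (over every place of `F₀` there is a place of `K`; the tree's
`PlaceSection.nonempty`, restricted to the places over `p`). [cite: Mochizuki2012, IUTchI Def. 3.1 (e) p. 62] -/
theorem exists_section_placesOver (p : ℕ) [Fact p.Prime] :
    ∃ s : placesOver F₀ p → placesOver K p, ∀ v, finBelow F₀ K (s v).1 = v.1 := by
  obtain ⟨σ⟩ := PlaceSection.nonempty F₀ K
  exact ⟨fun v => ⟨σ.lift v.1, σ.lift_mem_placesOver v⟩, fun v =>
    (finBelow_eq_under F₀ K _).trans (σ.under_lift v.1)⟩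

omit [NumberField F₀] [NumberField K] in
/-- The section of the places over `p` induced by a `PlaceSection` (`v ↦ v̲ = σ.lift v`) is a section of
`finBelow`. [cite: Mochizuki2012, IUTchI Def. 3.1 (e) p. 62] -/
theorem finBelow_lift (σ : PlaceSection F₀ K) (v : HeightOneSpectrum (𝓞 F₀)) :
    finBelow F₀ K (σ.lift v) = v :=
  (finBelow_eq_under F₀ K _).trans (σ.under_lift v)

/-! ## 2. Fibre-constant summands: the expectation descends -/

open scoped Classical in
/-- **Weight descent for expectations (tuples).** Let `q : (ι → V(K)_p) → ℝ` be constant on the fibres of the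
coordinatewise restriction `w⃗ ↦ (w_a ∩ 𝓞_{F₀})_a` and let `s` be any section of `V(K)_p → V(F₀)_p`. Then
`Σ_{w⃗ ∈ V(K)_p^ι} (Π_a Pr_K(w_a))·q(w⃗) = Σ_{v⃗ ∈ V(F₀)_p^ι} (Π_a Pr_{F₀}(v_a))·q(s ∘ v⃗)`:
regroup the left sum along the fibres, pull the constant value `q(s ∘ v⃗)` out of each fibre, and descend the
fibre's total weight by `sum_subtype_placesOver_prod_weight_eq`.
[cite: DupuyHilado2025, §3.6] [cite: Mochizuki2012, IUTchIV Thm. 1.10 proof Step (v) p. 28] -/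
theorem sum_prod_weight_mul_eq_of_fibreConst {p : ℕ} [Fact p.Prime] {ι : Type} [Fintype ι] [DecidableEq ι]
    (q : (ι → placesOver K p) → ℝ) (s : placesOver F₀ p → placesOver K p)
    (hs : ∀ v, finBelow F₀ K (s v).1 = v.1)
    (hq : ∀ w w' : ι → placesOver K p,
      (∀ a, finBelow F₀ K (w a).1 = finBelow F₀ K (w' a).1) → q w = q w') :
    ∑ w : ι → placesOver K p, (∏ a, weight K (w a).1) * q w =
      ∑ v : ι → placesOver F₀ p, (∏ a, weight F₀ (v a).1) * q (fun a => s (v a)) := by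
  classical
  -- the coordinatewise restriction of tuples of places
  let π : (ι → placesOver K p) → (ι → placesOver F₀ p) :=
    fun w a => ⟨finBelow F₀ K (w a).1, finBelow_mem_placesOver F₀ K (w a).2⟩
  have hπ : ∀ (w : ι → placesOver K p) (a : ι), (π w a).1 = finBelow F₀ K (w a).1 := fun w a => rfl
  rw [← Fintype.sum_fiberwise π]
  refine Finset.sum_congr rfl fun v _ => ?_
  -- on the fibre of `v⃗` the summand is the constant `q (s ∘ v⃗)`
  have hconst : ∀ w : {w : ι → placesOver K p // π w = v},
      (∏ a, weight K (w.1 a).1) * q w.1 = (∏ a, weight K (w.1 a).1) * q (fun a => s (v a)) := by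
    intro w
    congr 1
    refine hq _ _ fun a => ?_
    rw [← hπ, w.2, hs]
  rw [Fintype.sum_congr _ _ hconst, ← Finset.sum_mul]
  congr 1
  -- the fibre `{w⃗ // π w⃗ = v⃗}` is the subtype of tuples lying coordinatewise over `v⃗`
  let E : {w : ι → placesOver K p // π w = v} ≃
      {w : ι → placesOver K p // ∀ a, finBelow F₀ K (w a).1 = (v a).1} :=
    { toFun := fun w => ⟨w.1, fun a => by rw [← hπ, w.2]⟩
      invFun := fun w => ⟨w.1, funext fun a => Subtype.ext (by rw [hπ]; exact w.2 a)⟩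
      left_inv := fun w => rfl
      right_inv := fun w => rfl }
  rw [Fintype.sum_equiv E (fun w => ∏ a, weight K (w.1 a).1) (fun w => ∏ a, weight K (w.1 a).1)
    fun w => rfl]
  exact sum_subtype_placesOver_prod_weight_eq F₀ K v

open scoped Classical in
/-- **Weight descent for expectations (one place).** For `f : V(K)_p → ℝ` constant on the fibres of
`w ↦ w ∩ 𝓞_{F₀}` and any section `s`: `Σ_{w ∈ V(K)_p} Pr_K(w)·f(w) = Σ_{v ∈ V(F₀)_p} Pr_{F₀}(v)·f(s v)`.
[cite: DupuyHilado2025, §3.6] [cite: NeukirchANT1999, Ch. I §8 Prop. (8.2)] -/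
theorem sum_weight_mul_eq_of_fibreConst {p : ℕ} [Fact p.Prime] (f : placesOver K p → ℝ)
    (s : placesOver F₀ p → placesOver K p) (hs : ∀ v, finBelow F₀ K (s v).1 = v.1)
    (hf : ∀ w w' : placesOver K p, finBelow F₀ K w.1 = finBelow F₀ K w'.1 → f w = f w') :
    ∑ w : placesOver K p, weight K w.1 * f w = ∑ v : placesOver F₀ p, weight F₀ v.1 * f (s v) := by
  classical
  have h := sum_prod_weight_mul_eq_of_fibreConst F₀ K (ι := Unit) (fun w => f (w ())) s hs
    (fun w w' hww' => hf _ _ (hww' ()))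
  -- re-index the sums over `Unit → X` by `X`
  have eK : ∑ w : Unit → placesOver K p, (∏ a, weight K (w a).1) * f (w ()) =
      ∑ w : placesOver K p, weight K w.1 * f w :=
    Fintype.sum_equiv (Equiv.funUnique Unit (placesOver K p)) _ _ fun w => by
      rw [Fintype.prod_unique]; rfl
  have eF : ∑ v : Unit → placesOver F₀ p, (∏ a, weight F₀ (v a).1) * f (s (v ())) =
      ∑ v : placesOver F₀ p, weight F₀ v.1 * f (s v) :=
    Fintype.sum_equiv (Equiv.funUnique Unit (placesOver F₀ p)) _ _ fun v => by
      rw [Fintype.prod_unique]; rfl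
  exact eK.symm.trans (h.trans eF)

/-! ## 3. Galois-invariant summands are fibre-constant -/

/-- **For `K/F₀` Galois, a summand invariant under the componentwise action of `Gal(K/F₀)^ι` on tuples of
places over `p` is constant on the fibres of `w⃗ ↦ (w_a ∩ 𝓞_{F₀})_a`** — `Gal(K/F₀)` is transitive on the
places of `K` over a given place of `F₀` (Cassels–Fröhlich VII Prop. 1.2 (ii), tree
`HeightOneSpectrum.exists_algEquiv_smul_eq`), so two tuples over the same `v⃗` differ by some `g⃗`.
[cite: CasselsFrohlichANT1967, Ch. VII Prop. 1.2 (ii)] -/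
theorem fibreConst_of_smul_invariant [IsGalois F₀ K] {p : ℕ} [Fact p.Prime] {ι : Type} {X : Sort*}
    (q : (ι → placesOver K p) → X)
    (hq : ∀ (g : ι → (K ≃ₐ[F₀] K)) (w : ι → placesOver K p),
      q (fun a => ⟨g a • (w a).1, smul_mem_placesOver F₀ K (g a) (w a).2⟩) = q w)
    (w w' : ι → placesOver K p) (h : ∀ a, finBelow F₀ K (w a).1 = finBelow F₀ K (w' a).1) :
    q w = q w' := by
  have hex : ∀ a, ∃ g : K ≃ₐ[F₀] K, g • (w a).1 = (w' a).1 := fun a =>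
    HeightOneSpectrum.exists_algEquiv_smul_eq (F := F₀) (by
      rw [← finBelow_eq_under, ← finBelow_eq_under]; exact h a)
  choose g hg using hex
  have hw' : w' = fun a => ⟨g a • (w a).1, smul_mem_placesOver F₀ K (g a) (w a).2⟩ :=
    funext fun a => Subtype.ext (hg a).symm
  rw [hw', hq]

/-- One-place form: for `K/F₀` Galois, a `Gal(K/F₀)`-invariant function of the places of `K` over `p` is
constant on the fibres of `w ↦ w ∩ 𝓞_{F₀}`. [cite: CasselsFrohlichANT1967, Ch. VII Prop. 1.2 (ii)] -/
theorem fibreConst_of_smul_invariant_one [IsGalois F₀ K] {p : ℕ} [Fact p.Prime] {X : Sort*}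
    (f : placesOver K p → X)
    (hf : ∀ (g : K ≃ₐ[F₀] K) (w : placesOver K p), f ⟨g • w.1, smul_mem_placesOver F₀ K g w.2⟩ = f w)
    (w w' : placesOver K p) (h : finBelow F₀ K w.1 = finBelow F₀ K w'.1) : f w = f w' := by
  obtain ⟨g, hg⟩ := HeightOneSpectrum.exists_algEquiv_smul_eq (F := F₀) (E := K) (w := w.1) (w' := w'.1)
    (by rw [← finBelow_eq_under, ← finBelow_eq_under]; exact h)
  have hw' : w' = ⟨g • w.1, smul_mem_placesOver F₀ K g w.2⟩ := Subtype.ext hg.symm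
  rw [hw', hf]

/-! ## 4. The composite: Galois-invariant summands average over `V(K)_p` as over the chosen section -/

open scoped Classical in
/-- **Weight descent for the expectation of a Galois-invariant packet summand.** For `K/F₀` Galois,
`q : (ι → V(K)_p) → ℝ` invariant under the componentwise action of `Gal(K/F₀)^ι`, and any section `s` of
`V(K)_p → V(F₀)_p`: `Σ_{w⃗ ∈ V(K)_p^ι} Pr_K(w⃗)·q(w⃗) = Σ_{v⃗ ∈ V(F₀)_p^ι} Pr_{F₀}(v⃗)·q(s ∘ v⃗)` — the `K`-level
weighted average IS the `F₀`-level weighted average of the values at the chosen places.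
[cite: DupuyHilado2025, §3.6] [cite: Mochizuki2012, IUTchIV Thm. 1.10 proof Step (v) p. 28]
[cite: CasselsFrohlichANT1967, Ch. VII Prop. 1.2 (ii)] -/
theorem sum_prod_weight_mul_eq_of_smul_invariant [IsGalois F₀ K] {p : ℕ} [Fact p.Prime] {ι : Type}
    [Fintype ι] [DecidableEq ι] (q : (ι → placesOver K p) → ℝ)
    (hq : ∀ (g : ι → (K ≃ₐ[F₀] K)) (w : ι → placesOver K p),
      q (fun a => ⟨g a • (w a).1, smul_mem_placesOver F₀ K (g a) (w a).2⟩) = q w)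
    (s : placesOver F₀ p → placesOver K p) (hs : ∀ v, finBelow F₀ K (s v).1 = v.1) :
    ∑ w : ι → placesOver K p, (∏ a, weight K (w a).1) * q w =
      ∑ v : ι → placesOver F₀ p, (∏ a, weight F₀ (v a).1) * q (fun a => s (v a)) :=
  sum_prod_weight_mul_eq_of_fibreConst F₀ K q s hs (fibreConst_of_smul_invariant F₀ K q hq)

open scoped Classical in
/-- **The same over a `PlaceSection`** (`v ↦ v̲ = σ.lift v`, [IUTchI] Def. 3.1 (e) "`V̲ ⥲ V_mod`"): for `K/F₀`
Galois and a Galois-invariant summand,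
`Σ_{w⃗ ∈ V(K)_p^ι} Pr_K(w⃗)·q(w⃗) = Σ_{v⃗ ∈ V(F₀)_p^ι} Pr_{F₀}(v⃗)·q(v̲⃗)`.
[cite: Mochizuki2012, IUTchI Def. 3.1 (e) p. 62] [cite: Mochizuki2012, IUTchIV Thm. 1.10 proof Step (v) p. 28] -/
theorem sum_prod_weight_mul_eq_of_smul_invariant_placeSection [IsGalois F₀ K] {p : ℕ} [Fact p.Prime]
    {ι : Type} [Fintype ι] [DecidableEq ι] (σ : PlaceSection F₀ K) (q : (ι → placesOver K p) → ℝ)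
    (hq : ∀ (g : ι → (K ≃ₐ[F₀] K)) (w : ι → placesOver K p),
      q (fun a => ⟨g a • (w a).1, smul_mem_placesOver F₀ K (g a) (w a).2⟩) = q w) :
    ∑ w : ι → placesOver K p, (∏ a, weight K (w a).1) * q w =
      ∑ v : ι → placesOver F₀ p, (∏ a, weight F₀ (v a).1) *
        q (fun a => ⟨σ.lift (v a).1, σ.lift_mem_placesOver (v a)⟩) :=
  sum_prod_weight_mul_eq_of_smul_invariant F₀ K q hq (fun v => ⟨σ.lift v.1, σ.lift_mem_placesOver v⟩)
    fun v => finBelow_lift F₀ K σ v.1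

open scoped Classical in
/-- **One-place composite**: for `K/F₀` Galois, a `Gal(K/F₀)`-invariant `f : V(K)_p → ℝ` and a `PlaceSection`,
`Σ_{w ∈ V(K)_p} Pr_K(w)·f(w) = Σ_{v ∈ V(F₀)_p} Pr_{F₀}(v)·f(v̲)` (the shape of the different term of [IUTchIV]
Thm. 1.10 Step (v), `DifferentOrdGaloisFibre.lean`, for an arbitrary invariant local quantity).
[cite: Mochizuki2012, IUTchIV Thm. 1.10 proof Step (v) p. 28] [cite: CasselsFrohlichANT1967, Ch. VII Prop. 1.2 (ii)] -/
theorem sum_weight_mul_eq_of_smul_invariant_placeSection [IsGalois F₀ K] {p : ℕ} [Fact p.Prime]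
    (σ : PlaceSection F₀ K) (f : placesOver K p → ℝ)
    (hf : ∀ (g : K ≃ₐ[F₀] K) (w : placesOver K p), f ⟨g • w.1, smul_mem_placesOver F₀ K g w.2⟩ = f w) :
    ∑ w : placesOver K p, weight K w.1 * f w =
      ∑ v : placesOver F₀ p, weight F₀ v.1 * f ⟨σ.lift v.1, σ.lift_mem_placesOver v⟩ :=
  sum_weight_mul_eq_of_fibreConst F₀ K f (fun v => ⟨σ.lift v.1, σ.lift_mem_placesOver v⟩)
    (fun v => finBelow_lift F₀ K σ v.1) (fibreConst_of_smul_invariant_one F₀ K f hf)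

/-- **Sanity instance of invariance: the total weight.** The constant summand `1` is invariant, and the
descent formula specialises to `Σ_{w⃗} Pr_K(w⃗) = Σ_{v⃗} Pr_{F₀}(v⃗)` (both are `(Σ_{v ∈ V(·)_p} Pr(v))^{#ι}`; no
Galois hypothesis is needed for this instance, which is `sum_prod_weight_mul_eq_of_fibreConst` at `q = 1`).
[cite: DupuyHilado2025, §3.6] -/
theorem sum_prod_weight_eq_sum_prod_weight {p : ℕ} [Fact p.Prime] {ι : Type} [Fintype ι] [DecidableEq ι] :
    ∑ w : ι → placesOver K p, ∏ a, weight K (w a).1 = ∑ v : ι → placesOver F₀ p, ∏ a, weight F₀ (v a).1 := by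
  classical
  obtain ⟨s, hs⟩ := exists_section_placesOver F₀ K p
  have h := sum_prod_weight_mul_eq_of_fibreConst F₀ K (ι := ι) (fun _ => (1 : ℝ)) s hs
    (fun _ _ _ => rfl)
  simpa using h

end Literature.IUT.LogVolume

end
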